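import Summits.Ventures.PercRepro.GenQLevelThree

/-!
# PercRepro — C-025 at `(q + 2, q)`: the type-`1` balance holds for EVERY rank-`q` set when `q ≤ 5`
(night-4, gen 0)

`Jq_one_nonneg` (`GenQTypeOne`) closes type `1` for `(g − q)(q + 3) ≥ q² − 1` and `Jq_one_nonneg_of_card_le_succ`
(`GenQLevelThree`) for `g ≤ q + 1`.  The remaining size `g = q + 2` closes when `q ≤ 5`
(`Jq_one_nonneg_of_card_eq_add_two`): at most `C(q + 2, 2)` independent `q`-sets, each in `2` of the
`(q + 1)`-point sets (`card_Iq_mul_le`), and the arithmetic `(q + 1)(q + 2)(q² − 2q − 7) ≤ 2(q + 1)(q + 2)(q − 1)`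
⟺ `(q − 5)(q + 1) ≤ 0` — tight at `q = 5` (the `21` independent `5`-sets of `U_{5,7}`).  Since the threshold of
`Jq_one_nonneg` is met by every `g ≥ q + 3` exactly when `(q − 5)(q + 2) ≤ 0`:

* **`Jq_one_nonneg_of_le_five`**: for `2 ≤ q ≤ 5`, `0 ≤ Jq M G q 1` on EVERY rank-`q` set `G` of a simple matroid.
  At `q = 4` this re-derives the landed `J_one_nonneg` (`SixFourT1`); at `q = 5` it removes type `1` from the
  residue of the first open row `(7, 5)`: `PerFlatResidueBelowFlat 5` is now the balances at the types `t = 2, 3, 4`.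
-/

namespace PercRepro.GenQ

open Finset ThmH SixFour

variable {α : Type*} [DecidableEq α] {M : Matroid α} [M.Finite]

/-- **The type-`1` balance for `g = q + 2` when `q ≤ 5`.** -/
theorem Jq_one_nonneg_of_card_eq_add_two (hs : Simple M) {G : Finset α} {q : ℕ} (hG : G ⊆ gr M)
    (hr : M.eRk (G : Set α) = (q : ℕ∞)) (hq : 2 ≤ q) (hq5 : q ≤ 5) (hg : G.card = q + 2) :
    0 ≤ Jq M G q 1 := by
  classical
  set I := Iq M G q with hI
  set Rb := (Rq M G q).filter (fun B : Finset α => ¬ B.card = q) with hRb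
  have hN : (Nq M G q : ℚ) = (I.card : ℚ) + (Rb.card : ℚ) := by
    rw [hI, hRb, Iq]
    unfold Nq
    exact_mod_cast (Finset.card_filter_add_card_filter_not _).symm
  have hNq1 : (Nq1 M G q).card ≤ Rb.card := by
    apply Finset.card_le_card
    intro B hB
    rw [Nq1, Finset.mem_filter] at hB
    rw [hRb, Finset.mem_filter]
    exact ⟨hB.1, by omega⟩
  -- the double count: `2 · I ≤ (q + 1) · N_{q+1}`
  have hdc := card_Iq_mul_le (M := M) hr
  rw [hg, show q + 2 - q = 2 by omega] at hdc
  -- at most `C(q + 2, 2)` independent `q`-sets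
  have hIle : I.card ≤ (q + 2).choose 2 := by
    have h1 : I ⊆ G.powersetCard q := by
      intro B hB
      rw [hI, Iq, Finset.mem_filter, mem_Rq] at hB
      rw [Finset.mem_powersetCard]
      exact ⟨hB.1.1, hB.2⟩
    have h2 := Finset.card_le_card h1
    rw [Finset.card_powersetCard, hg, Nat.choose_symm_of_eq_add (show q + 2 = q + 2 by rfl)] at h2
    exact h2
  have hq' : (2 : ℚ) ≤ q := by exact_mod_cast hq
  have hq1 : (0 : ℚ) < (q : ℚ) - 1 := by linarith
  have hI1 : (I.card : ℚ) * 1 ≤ ∑ B ∈ I, ((q : ℚ) + 2 - (1 : ℕ)) * wInf M B := by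
    rw [← nsmul_eq_mul]
    apply Finset.card_nsmul_le_sum
    intro B hB
    rw [hI, Iq, Finset.mem_filter, mem_Rq] at hB
    have hw := wInf_ge_of_eRk_eq (hB.1.1.trans hG) hB.1.2
    calc (1 : ℚ) = ((q : ℚ) + 1) * (1 / ((q : ℚ) + 1)) := by field_simp
      _ ≤ ((q : ℚ) + 1) * wInf M B := by gcongr
      _ = ((q : ℚ) + 2 - (1 : ℕ)) * wInf M B := by push_cast; ring
  have hR1 : (Rb.card : ℚ) * (((q : ℚ) + 1) / ((q : ℚ) - 1)) ≤
      ∑ B ∈ Rb, ((q : ℚ) + 2 - (1 : ℕ)) * wInf M B := by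
    rw [← nsmul_eq_mul]
    apply Finset.card_nsmul_le_sum
    intro B hB
    rw [hRb, Finset.mem_filter, mem_Rq] at hB
    have hcard : q + 1 ≤ B.card := by
      have h4 := M.eRk_le_encard (B : Set α)
      rw [hB.1.2, Set.encard_coe_eq_coe_finsetCard] at h4
      have h4' : q ≤ B.card := by exact_mod_cast h4
      omega
    have hw := wInf_ge_of_succ_le_card hs (by omega) (hB.1.1.trans hG) hB.1.2 hcard
    calc ((q : ℚ) + 1) / ((q : ℚ) - 1) = ((q : ℚ) + 1) * (1 / ((q : ℚ) - 1)) := by ring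
      _ ≤ ((q : ℚ) + 1) * wInf M B := by gcongr
      _ = ((q : ℚ) + 2 - (1 : ℕ)) * wInf M B := by push_cast; ring
  have hsplit : ∑ B ∈ Rq M G q, ((q : ℚ) + 2 - (1 : ℕ)) * wInf M B =
      ∑ B ∈ I, ((q : ℚ) + 2 - (1 : ℕ)) * wInf M B + ∑ B ∈ Rb, ((q : ℚ) + 2 - (1 : ℕ)) * wInf M B := by
    rw [hI, hRb, Iq]
    exact (Finset.sum_filter_add_sum_filter_not _ _ _).symm
  have hDF : (1 : ℚ) ≤ (DFq M G q 1 : ℚ) := by exact_mod_cast one_le_DFq_one hr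
  have hR0 : (0 : ℚ) ≤ Rb.card := by positivity
  have hΦ : (0 : ℚ) ≤ ((q : ℚ) + 2) / ((q : ℚ) + 1) := by positivity
  have hmono : (((q : ℚ) + 2) / ((q : ℚ) + 1)) * ((I.card : ℚ) + (Rb.card : ℚ) - (DFq M G q 1 : ℚ)) ≤
      (((q : ℚ) + 2) / ((q : ℚ) + 1)) * ((I.card : ℚ) + (Rb.card : ℚ) - 1) := by
    apply mul_le_mul_of_nonneg_left _ hΦ
    linarith
  -- the key inequality `I (q − 1) ≤ Rb (q + 3) + (q + 2)(q − 1)`, case by case in `q`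
  have hA : (I.card : ℚ) * ((q : ℚ) - 1) ≤ (Rb.card : ℚ) * ((q : ℚ) + 3) + ((q : ℚ) + 2) * ((q : ℚ) - 1) := by
    have hdc' : 2 * (I.card : ℚ) ≤ ((q : ℚ) + 1) * (Rb.card : ℚ) := by
      have h := (Nat.cast_le (α := ℚ)).2 (hdc.trans (Nat.mul_le_mul_left (q + 1) hNq1))
      push_cast at h
      linarith
    interval_cases q
    all_goals
      norm_num [Nat.choose] at hIle hdc' ⊢
      have hIq := (Nat.cast_le (α := ℚ)).2 hIle
      push_cast at hIq
      linarith
  have key : (0 : ℚ) ≤ (I.card : ℚ) * 1 + (Rb.card : ℚ) * (((q : ℚ) + 1) / ((q : ℚ) - 1)) -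
      (((q : ℚ) + 2) / ((q : ℚ) + 1)) * ((I.card : ℚ) + (Rb.card : ℚ) - 1) := by
    have e : (I.card : ℚ) * 1 + (Rb.card : ℚ) * (((q : ℚ) + 1) / ((q : ℚ) - 1)) -
        (((q : ℚ) + 2) / ((q : ℚ) + 1)) * ((I.card : ℚ) + (Rb.card : ℚ) - 1) =
        ((Rb.card : ℚ) * ((q : ℚ) + 3) + ((q : ℚ) + 2) * ((q : ℚ) - 1) - (I.card : ℚ) * ((q : ℚ) - 1)) /
          (((q : ℚ) + 1) * ((q : ℚ) - 1)) := by
      field_simp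
      ring
    rw [e]
    apply div_nonneg
    · linarith
    · positivity
  unfold Jq
  rw [hsplit, hN]
  set a : ℚ := ((q : ℚ) + 1) / ((q : ℚ) - 1) with ha
  set Φ : ℚ := ((q : ℚ) + 2) / ((q : ℚ) + 1) with hΦdef
  set SI := ∑ B ∈ I, ((q : ℚ) + 2 - (1 : ℕ)) * wInf M B with hSI
  set SR := ∑ B ∈ Rb, ((q : ℚ) + 2 - (1 : ℕ)) * wInf M B with hSR
  linarith [hI1, hR1, key, hmono]

/-- **The type-`1` balance on every rank-`q` set for `2 ≤ q ≤ 5`**: `g ≤ q + 1` by the small cases, `g = q + 2`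
above, `g ≥ q + 3` by the threshold of `Jq_one_nonneg` (met for every such `g` exactly when `q ≤ 5`). -/
theorem Jq_one_nonneg_of_le_five (hs : Simple M) {G : Finset α} {q : ℕ} (hG : G ⊆ gr M)
    (hr : M.eRk (G : Set α) = (q : ℕ∞)) (hq : 2 ≤ q) (hq5 : q ≤ 5) : 0 ≤ Jq M G q 1 := by
  rcases (show G.card ≤ q + 1 ∨ G.card = q + 2 ∨ q + 3 ≤ G.card by omega) with h | h | h
  · exact Jq_one_nonneg_of_card_le_succ hs hG hr hq h
  · exact Jq_one_nonneg_of_card_eq_add_two hs hG hr hq hq5 h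
  · apply Jq_one_nonneg hs hG hr hq
    have h3 : 3 * (q + 3) ≤ (G.card - q) * (q + 3) := Nat.mul_le_mul_right (q + 3) (by omega)
    have h4 : q * q ≤ 3 * (q + 3) + 1 := by
      interval_cases q <;> norm_num
    omega

end PercRepro.GenQ
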